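/-
Copyright (c) 2026 the pub-hodgecm-mathlib formalisation cell (harness21).  Prover seat hodgecm-mathlib-K2E3-p25 (g2), HCML Track B «K2-LIT»,
h413 = `stmt-HodgeConjecture-24833`, road (11-3-split-nsc), leaf (nsc-S-A′), brick (E4b-1γ, part 3c = REDUCTION of the open cell to the points `w·n(v)·ι̂(k)`,
`k ∈ GL₂(𝒪)`) of the weak cell lemma (dealer D105′).  2026-09-04.
-/
import Summits.HodgeConjecture.HodgeConjecture.Theorems.K2E3GL3BorelInducedJacquetQOpenCellAlgebra   -- ★ part 2a
import Literature.NumberTheory.Automorphic.IwasawaDecompositionGL                                   -- ★ `exists_borel_mul_glInt`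
import HarnessLib

/-!
# K2_E3 road (h413), leaf (nsc-S-A′), brick E4b-1γ part 3c — every point of the open cell is `b · w · n(v) · ι̂(k)` with `b ∈ B`, `k ∈ GL₂(𝒪)`

Cell `pub/hodgecm-mathlib` (D-0151), Track B, seat K2E3-p25 (g2).  `--supports stmt-HodgeConjecture-24833 --as helper`; THEOREMS ONLY (no `def`, no instance, no notation,
no `sorry`); never imports `Cruxes/…/Lines`.  COUNT-NEUTRAL.

THE MATHEMATICS ([BernsteinZelevinsky1977, §5 (the open `(B,P)`-double coset `B w P`)]; [Bump1997, Prop. 4.5.2 (Iwasawa)]).  `m(x) = x₁₀x₂₁ − x₁₁x₂₀ ≠ 0`.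
* §1 ROW REDUCTION inside `U₃ ≤ B`: `β = t₀₁(s)·t₀₂(r)` with `(βx)₀₀ = (βx)₀₁ = 0` (Cramer in the invertible block `{1,2}×{0,1}`): `exists_upper_mul_row_zero`.
* §2 A matrix `y` with `y₀₀ = y₀₁ = 0` (and `m(y) ≠ 0`) IS a cell point up to the torus: `y = diag(y₀₂,1,1) · w · n(y₁₂, y₂₂) · ι̂(A)`, `A = (y_{ij})_{i∈{1,2}, j∈{0,1}}`
  (`eq_diag_mul_cellPoint`; ★ part 2a `cellPoint_apply`).
* §3 IWASAWA in the block: `ι̂(b₂ k)` with `b₂ ∈ B₂`, `k ∈ GL₂(𝒪)` (★ `exists_borel_mul_glInt`), and `w·n(v)·ι̂(b₂)·ι̂(k) = (w ι̂(b₂) w⁻¹)·w·n(b₂⁻¹v)·ι̂(k)` (★ part 2a):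
  altogether **`exists_borel_mul_eq_cellPoint_glInt`**: for `m(x) ≠ 0` there are `b ∈ B`, `v`, `k ∈ GL₂(𝒪)` with `x = b · w · n(v) · ι̂(k)`.
Part 3d evaluates `e_K f` at such points.

HONEST LABEL: HC_CM is proved only modulo the 7 printed citations (2 remaining named inputs: hLiu418 = stmt-HodgeConjecture-24832, h413 = stmt-HodgeConjecture-24833) until rung 0
closes; count-neutral helper.

## References
* [BernsteinZelevinsky1977] I. N. Bernstein, A. V. Zelevinsky, *Induced representations of reductive p-adic groups I*, Ann. Sci. ÉNS 10 (1977), §5.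
* [Bump1997] D. Bump, *Automorphic Forms and Representations* (1997), Prop. 4.5.2.
-/

set_option autoImplicit false
set_option linter.dupNamespace false

noncomputable section

open Function
open scoped MatrixGroups
open Literature.NumberTheory.Automorphic
open Summit.HodgeConjecture.HodgeConjecture.Cruxes.H413.K2E3GL3BorelInducedJacquetQOpenCellAlgebra

namespace Summit.HodgeConjecture.HodgeConjecture.Cruxes.H413.K2E3GL3BorelInducedJacquetQOpenCellReduction

variable {F : Type} [Field F] [ValuativeRel F] [TopologicalSpace F] [IsNonarchimedeanLocalField F]
  (h02 : (0 : Fin 3) ≠ 2) (h12 : (1 : Fin 3) ≠ 2)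

/-! ## §1 Row reduction by upper unitriangular matrices -/

omit [ValuativeRel F] [TopologicalSpace F] [IsNonarchimedeanLocalField F] in
/-- Entries of `t₀₁(s)·t₀₂(r)·x`: row `0` becomes `x₀ + s·x₁ + r·x₂`, rows `1, 2` are unchanged. [folklore] -/
theorem upper_mul_apply (h01 : (0 : Fin 3) ≠ 1) (s r : F) (x : GL (Fin 3) F) (i j : Fin 3) :
    ((transvectionUnit 0 1 h01 s * transvectionUnit 0 2 h02 r * x : GL (Fin 3) F) : Matrix (Fin 3) (Fin 3) F) i j =
      (x : Matrix (Fin 3) (Fin 3) F) i j +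
        (if i = 0 then s * (x : Matrix (Fin 3) (Fin 3) F) 1 j + r * (x : Matrix (Fin 3) (Fin 3) F) 2 j else 0) := by
  rw [Units.val_mul, Units.val_mul, coe_transvectionUnit, coe_transvectionUnit]
  fin_cases i
  all_goals simp [Matrix.mul_apply, Fin.sum_univ_three, Matrix.single_apply, Matrix.one_apply]
  all_goals ring

omit [ValuativeRel F] [TopologicalSpace F] [IsNonarchimedeanLocalField F] in
/-- **ROW REDUCTION**: for `m(x) ≠ 0` there are `s, r` with `(t₀₁(s) t₀₂(r) x)₀₀ = (t₀₁(s) t₀₂(r) x)₀₁ = 0` (Cramer). [cite: BernsteinZelevinsky1977, §5] -/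
theorem exists_upper_mul_row_zero (h01 : (0 : Fin 3) ≠ 1) (x : GL (Fin 3) F)
    (hm : (x : Matrix (Fin 3) (Fin 3) F) 1 0 * (x : Matrix (Fin 3) (Fin 3) F) 2 1 - (x : Matrix (Fin 3) (Fin 3) F) 1 1 * (x : Matrix (Fin 3) (Fin 3) F) 2 0 ≠ 0) :
    ∃ s r : F, ((transvectionUnit 0 1 h01 s * transvectionUnit 0 2 h02 r * x : GL (Fin 3) F) : Matrix (Fin 3) (Fin 3) F) 0 0 = 0 ∧
      ((transvectionUnit 0 1 h01 s * transvectionUnit 0 2 h02 r * x : GL (Fin 3) F) : Matrix (Fin 3) (Fin 3) F) 0 1 = 0 := by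
  set m := (x : Matrix (Fin 3) (Fin 3) F) 1 0 * (x : Matrix (Fin 3) (Fin 3) F) 2 1 - (x : Matrix (Fin 3) (Fin 3) F) 1 1 * (x : Matrix (Fin 3) (Fin 3) F) 2 0 with hmdef
  refine ⟨(-(x : Matrix (Fin 3) (Fin 3) F) 0 0 * (x : Matrix (Fin 3) (Fin 3) F) 2 1 + (x : Matrix (Fin 3) (Fin 3) F) 0 1 * (x : Matrix (Fin 3) (Fin 3) F) 2 0) / m,
    (-(x : Matrix (Fin 3) (Fin 3) F) 0 1 * (x : Matrix (Fin 3) (Fin 3) F) 1 0 + (x : Matrix (Fin 3) (Fin 3) F) 0 0 * (x : Matrix (Fin 3) (Fin 3) F) 1 1) / m, ?_, ?_⟩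
  · rw [upper_mul_apply h02 h01, if_pos rfl]
    field_simp
    rw [hmdef]; ring
  · rw [upper_mul_apply h02 h01, if_pos rfl]
    field_simp
    rw [hmdef]; ring

omit [ValuativeRel F] [TopologicalSpace F] [IsNonarchimedeanLocalField F] in
/-- `t₀₁(s) t₀₂(r)` is upper triangular. [folklore] -/
theorem upper_mem_borel (h01 : (0 : Fin 3) ≠ 1) (s r : F) :
    (transvectionUnit 0 1 h01 s * transvectionUnit 0 2 h02 r : GL (Fin 3) F) ∈ standardParabolicGL F (id : Fin 3 → Fin 3) := by
  rw [mem_standardParabolicGL_iff]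
  intro i j hij
  have h := upper_mul_apply h02 h01 s r 1 i j
  rw [mul_one] at h
  rw [h, Units.val_one]
  fin_cases i <;> fin_cases j <;> simp_all

/-! ## §2 A point with `y₀₀ = y₀₁ = 0` is a torus translate of a cell point -/

variable (D : GL (Fin 2) F →* GL (Fin 3) F)
  (hD : ∀ g : GL (Fin 2) F, ((D g : GL (Fin 3) F) : Matrix (Fin 3) (Fin 3) F) =
    !![(g : Matrix (Fin 2) (Fin 2) F) 0 0, (g : Matrix (Fin 2) (Fin 2) F) 0 1, 0;
       (g : Matrix (Fin 2) (Fin 2) F) 1 0, (g : Matrix (Fin 2) (Fin 2) F) 1 1, 0;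
       0, 0, 1])

omit [ValuativeRel F] [TopologicalSpace F] [IsNonarchimedeanLocalField F] in
include hD in
/-- **`y = diag(y₀₂,1,1) · w · n(y₁₂,y₂₂) · ι̂(A)`** for `y₀₀ = y₀₁ = 0`, with `A = !![y₁₀,y₁₁; y₂₀,y₂₁]` (invertible as `m(y) ≠ 0`) and `y₀₂ ≠ 0`; the torus factor is upper
triangular. [cite: BernsteinZelevinsky1977, §5] -/
theorem exists_borel_mul_cellPoint_of_row_zero (y : GL (Fin 3) F) (h00 : (y : Matrix (Fin 3) (Fin 3) F) 0 0 = 0) (h01 : (y : Matrix (Fin 3) (Fin 3) F) 0 1 = 0)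
    (hm : (y : Matrix (Fin 3) (Fin 3) F) 1 0 * (y : Matrix (Fin 3) (Fin 3) F) 2 1 - (y : Matrix (Fin 3) (Fin 3) F) 1 1 * (y : Matrix (Fin 3) (Fin 3) F) 2 0 ≠ 0) :
    ∃ (b : GL (Fin 3) F) (A : GL (Fin 2) F), b ∈ standardParabolicGL F (id : Fin 3 → Fin 3) ∧
      y = b * (permGL (Equiv.swap (1 : Fin 3) 2 * Equiv.swap 0 1) *
        (transvectionUnit 0 2 h02 ((y : Matrix (Fin 3) (Fin 3) F) 1 2) * transvectionUnit 1 2 h12 ((y : Matrix (Fin 3) (Fin 3) F) 2 2)) * D A) := by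
  -- `t = y₀₂ ≠ 0`
  have ht : (y : Matrix (Fin 3) (Fin 3) F) 0 2 ≠ 0 := by
    intro h0
    have hdet : (y : Matrix (Fin 3) (Fin 3) F).det = 0 := Matrix.det_eq_zero_of_row_eq_zero 0 fun j => by
      fin_cases j
      · exact h00
      · exact h01
      · exact h0
    exact (y.isUnit.map Matrix.detMonoidHom).ne_zero (by simpa using hdet)
  let A : GL (Fin 2) F := Matrix.GeneralLinearGroup.mkOfDetNeZero !![(y : Matrix (Fin 3) (Fin 3) F) 1 0, (y : Matrix (Fin 3) (Fin 3) F) 1 1;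
    (y : Matrix (Fin 3) (Fin 3) F) 2 0, (y : Matrix (Fin 3) (Fin 3) F) 2 1] (by rw [Matrix.det_fin_two_of]; exact hm)
  let b : GL (Fin 3) F := Matrix.GeneralLinearGroup.mkOfDetNeZero (Matrix.diagonal ![(y : Matrix (Fin 3) (Fin 3) F) 0 2, 1, 1])
    (by rw [Matrix.det_diagonal]; simp [Fin.prod_univ_three, ht])
  have hA : ((A : GL (Fin 2) F) : Matrix (Fin 2) (Fin 2) F) = !![(y : Matrix (Fin 3) (Fin 3) F) 1 0, (y : Matrix (Fin 3) (Fin 3) F) 1 1;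
    (y : Matrix (Fin 3) (Fin 3) F) 2 0, (y : Matrix (Fin 3) (Fin 3) F) 2 1] := rfl
  have hb : ((b : GL (Fin 3) F) : Matrix (Fin 3) (Fin 3) F) = Matrix.diagonal ![(y : Matrix (Fin 3) (Fin 3) F) 0 2, 1, 1] := rfl
  refine ⟨b, A, ?_, ?_⟩
  · rw [mem_standardParabolicGL_iff]
    intro i j hij
    rw [hb, Matrix.diagonal_apply_ne _ (fun h => by rw [h] at hij; exact lt_irrefl _ hij)]
  · refine Units.ext (Matrix.ext fun i j => ?_)
    rw [Units.val_mul, hb, Matrix.diagonal_mul, cellPoint_apply h02 h12 D hD, hA]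
    fin_cases i <;> fin_cases j <;> simp [h00, h01]

/-! ## §3 Iwasawa in the block, and the assembled reduction -/

omit [TopologicalSpace F] [IsNonarchimedeanLocalField F] in
include hD in
/-- **EVERY POINT OF THE OPEN CELL IS `b · w · n(v) · ι̂(k)` WITH `b ∈ B`, `k ∈ GL₂(𝒪)`.** [cite: BernsteinZelevinsky1977, §5] [cite: Bump1997, Prop. 4.5.2] -/
theorem exists_borel_mul_eq_cellPoint_glInt (h01 : (0 : Fin 3) ≠ 1) (x : GL (Fin 3) F)
    (hm : (x : Matrix (Fin 3) (Fin 3) F) 1 0 * (x : Matrix (Fin 3) (Fin 3) F) 2 1 - (x : Matrix (Fin 3) (Fin 3) F) 1 1 * (x : Matrix (Fin 3) (Fin 3) F) 2 0 ≠ 0) :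
    ∃ (b : GL (Fin 3) F) (v : Fin 2 → F) (k : GL (Fin 2) F), b ∈ standardParabolicGL F (id : Fin 3 → Fin 3) ∧ k ∈ glInt 2 F ∧
      x = b * (permGL (Equiv.swap (1 : Fin 3) 2 * Equiv.swap 0 1) * (transvectionUnit 0 2 h02 (v 0) * transvectionUnit 1 2 h12 (v 1)) * D k) := by
  -- §1: `β x` has `(βx)₀₀ = (βx)₀₁ = 0`
  obtain ⟨s, r, h00, h01'⟩ := exists_upper_mul_row_zero h02 h01 x hm
  set β : GL (Fin 3) F := transvectionUnit 0 1 h01 s * transvectionUnit 0 2 h02 r with hβ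
  have hβB : β ∈ standardParabolicGL F (id : Fin 3 → Fin 3) := upper_mem_borel h02 h01 s r
  -- the minor of `β x` is that of `x`
  have hm' : ((β * x : GL (Fin 3) F) : Matrix (Fin 3) (Fin 3) F) 1 0 * ((β * x : GL (Fin 3) F) : Matrix (Fin 3) (Fin 3) F) 2 1 -
      ((β * x : GL (Fin 3) F) : Matrix (Fin 3) (Fin 3) F) 1 1 * ((β * x : GL (Fin 3) F) : Matrix (Fin 3) (Fin 3) F) 2 0 ≠ 0 := by
    simp only [hβ, upper_mul_apply h02 h01, show (1 : Fin 3) ≠ 0 by decide, show (2 : Fin 3) ≠ 0 by decide, if_false, add_zero]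
    exact hm
  -- §2: `β x = b₁ · w n(a,b) D A`
  obtain ⟨b₁, A, hb₁, hy⟩ := exists_borel_mul_cellPoint_of_row_zero h02 h12 D hD (β * x) h00 h01' hm'
  -- §3: `A = b₂ k`
  obtain ⟨b₂, hb₂, k, hk, hA⟩ := exists_borel_mul_glInt A
  set a := ((β * x : GL (Fin 3) F) : Matrix (Fin 3) (Fin 3) F) 1 2 with ha
  set b := ((β * x : GL (Fin 3) F) : Matrix (Fin 3) (Fin 3) F) 2 2 with hb
  set w : GL (Fin 3) F := permGL (Equiv.swap (1 : Fin 3) 2 * Equiv.swap 0 1) with hw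
  -- `n(a,b) D b₂ = D b₂ n(b₂⁻¹ (a,b))`
  set v : Fin 2 → F := ((b₂⁻¹ : GL (Fin 2) F) : Matrix (Fin 2) (Fin 2) F).mulVec ![a, b] with hv
  have hcomm : (transvectionUnit 0 2 h02 a * transvectionUnit 1 2 h12 b : GL (Fin 3) F) * D b₂ =
      D b₂ * (transvectionUnit 0 2 h02 (v 0) * transvectionUnit 1 2 h12 (v 1)) := by
    have := uP_mul_diag h02 h12 D hD ![a, b] b₂
    simpa only [Matrix.cons_val_zero, Matrix.cons_val_one, Matrix.head_cons] using this
  refine ⟨β⁻¹ * b₁ * (w * D b₂ * w⁻¹), v, k, ?_, hk, ?_⟩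
  · exact Subgroup.mul_mem _ (Subgroup.mul_mem _ (Subgroup.inv_mem _ hβB) hb₁) (conj_permGL_diag_mem_borel D hD hb₂)
  · have hx : x = β⁻¹ * (β * x) := by rw [inv_mul_cancel_left]
    rw [hx, hy, hA, map_mul]
    -- both sides: `β⁻¹ b₁ w n(a,b) D b₂ D k`
    rw [show β⁻¹ * (b₁ * (w * (transvectionUnit 0 2 h02 a * transvectionUnit 1 2 h12 b) * (D b₂ * D k))) =
        β⁻¹ * b₁ * w * ((transvectionUnit 0 2 h02 a * transvectionUnit 1 2 h12 b) * D b₂) * D k by group, hcomm]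
    group

end Summit.HodgeConjecture.HodgeConjecture.Cruxes.H413.K2E3GL3BorelInducedJacquetQOpenCellReduction

end
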